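import Mathlib.Algebra.Homology.HomologicalComplex
import Mathlib.CategoryTheory.Abelian.Basic
import HarnessLib

/-!
# Staircase quotients and staircase image subcomplexes of a complex (powers of an integer)

Let `𝒜` be an abelian category (so `ℤ`-linear), `K` an `ℕ`-indexed cochain complex in `𝒜`, `q : ℤ`
and `e : ℕ → ℕ` an ANTITONE exponent function ("staircase"). Multiplication by `q ^ e j` on `Kʲ`
(`powSMul K q e j = (q ^ e j) • 𝟙`) is compatible with the differential up to the factor
`q ^ (e j - e (j+1))` (`powSMul_comp_d`), which gives two constructions:

* `powQuotient K q e he : CochainComplex 𝒜 ℕ` — the **staircase quotient** `(Kʲ / q^{e j} Kʲ)ⱼ`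
  (degreewise cokernels of `q ^ e j`, Mathlib's `cokernel`), with the projection `powQuotientπ`
  (degreewise epi) and the reduction maps `powQuotientMap` for `e ≤ e'` (`K/q^{e'} → K/q^{e}`),
  compatible with the projections (`powQuotientπ_comp_powQuotientMap`);
* `powImage Q q e he : CochainComplex 𝒜 ℕ` — the **staircase image subcomplex** `(q^{e j} Qʲ)ⱼ` of
  any complex `Q` (degreewise images of `q ^ e j`, Mathlib's `image` / `image.map`), with the
  inclusion `powImageι` (degreewise mono), the inclusions `powImageLE` for `e ≤ e'`
  (`q^{e'} Q ⊆ q^{e} Q`) and the push-forward `powImageMap` along a chain map.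

Motivation / use: for the de Rham complex `K = Ω•_{𝒳/W}` of a smooth `p`-adic formal lift and
`e j = (r - j) N`, `powQuotient` is the complex `(Ωʲ_{X_{(r-j)N}})_{j<r}` of reductions modulo
`p^{(r-j)N}` (terms `j ≥ r` are quotients by `p⁰ = 1`, i.e. zero), and `powImage` of it for
`e' j = (r - j) M` is X. Hu's complex `p^{r,M}_{r,N}Ω• = [p^{rM}𝒪_{X_{rN}} → p^{(r-1)M}Ω¹_{X_{(r-1)N}}
→ ⋯ → p^{M}Ω^{r-1}_{X_N}]` (X. Hu, arXiv:2507.12458, Def. 8.2), whose hypercohomology carries Hu's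
`K₀`-lifting obstruction; Bloch–Esnault–Kerz's `p(r)Ω^{<r}_{X_n}` (arXiv:1203.2776, §2) is the case
`M = 1`. Those specialisations live with the de Rham complex (`AlgebraicGeometry/Crystalline`); this
file is the abstract homological algebra. [folklore]

Everything is proved; no named facts. NOT here: the short exact sequences
`0 → q^{e'}Q_N → q^{e''}Q_N → q^{e''}Q_M → 0` and their exactness (needs `q`-torsion-freeness of the
terms of `K`), compatibility of `powImage` with `powQuotientMap` beyond the maps themselves.
-/

noncomputable section

namespace Literature.Algebra.Homology

open CategoryTheory CategoryTheory.Limits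

universe v u

variable {𝒜 : Type u} [Category.{v} 𝒜] [Abelian 𝒜]

/-! ### Multiplication by `q ^ e j` and the differential -/

section PowSMul

variable (K : CochainComplex 𝒜 ℕ) (q : ℤ) (e : ℕ → ℕ)

/-- Multiplication by `q ^ e j` on the `j`-th term `Kʲ`. [folklore] -/
abbrev powSMul (j : ℕ) : K.X j ⟶ K.X j := (q ^ e j : ℤ) • 𝟙 (K.X j)

variable {e} in
/-- For an antitone staircase `e`, `q^{e j} ≫ d = (q^{e j - e (j+1)} • d) ≫ q^{e (j+1)}`:
multiplication by `q ^ e j` followed by `d` factors through multiplication by `q ^ e (j+1)`.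
[folklore] -/
theorem powSMul_comp_d (he : Antitone e) (j : ℕ) :
    powSMul K q e j ≫ K.d j (j + 1) =
      ((q ^ (e j - e (j + 1)) : ℤ) • K.d j (j + 1)) ≫ powSMul K q e (j + 1) := by
  rw [Preadditive.zsmul_comp, Category.id_comp, Preadditive.zsmul_comp, Preadditive.comp_zsmul,
    Category.comp_id, smul_smul, pow_sub_mul_pow q (he (Nat.le_succ j))]

/-- Multiplication by `q ^ e j` commutes with every morphism (here: the components of a chain map).
[folklore] -/
theorem powSMul_comp {K L : CochainComplex 𝒜 ℕ} (φ : K ⟶ L) (j : ℕ) :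
    powSMul K q e j ≫ φ.f j = φ.f j ≫ powSMul L q e j := by
  rw [Preadditive.zsmul_comp, Category.id_comp, Preadditive.comp_zsmul, Category.comp_id]

/-- `q ^ e' j = q ^ (e' j - e j) • q ^ e j` for `e ≤ e'`. [folklore] -/
theorem powSMul_eq_smul_powSMul {e e' : ℕ → ℕ} (h : e ≤ e') (j : ℕ) :
    powSMul K q e' j = ((q ^ (e' j - e j)) : ℤ) • powSMul K q e j := by
  rw [smul_smul, pow_sub_mul_pow q (h j)]

end PowSMul

/-! ### The staircase quotient `K / q^{e} K` -/

section Quotient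

variable (K : CochainComplex 𝒜 ℕ) (q : ℤ) {e : ℕ → ℕ} (he : Antitone e)

/-- The differential of the staircase quotient, `Kʲ/q^{e j} → Kʲ⁺¹/q^{e (j+1)}`, induced by `d`
(well defined by `powSMul_comp_d`). [folklore] -/
def powQuotientD (j : ℕ) : cokernel (powSMul K q e j) ⟶ cokernel (powSMul K q e (j + 1)) :=
  cokernel.desc _ (K.d j (j + 1) ≫ cokernel.π _) (by
    rw [← Category.assoc, powSMul_comp_d K q he j, Category.assoc, cokernel.condition, comp_zero])

/-- `π ≫ d̄ = d ≫ π` for the staircase quotient differential. [folklore] -/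
@[reassoc (attr := simp)]
theorem π_powQuotientD (j : ℕ) :
    cokernel.π _ ≫ powQuotientD K q he j = K.d j (j + 1) ≫ cokernel.π _ :=
  cokernel.π_desc _ _ _

/-- The **staircase quotient complex** `K / q^{e} K = (Kʲ / q^{e j} Kʲ)ⱼ` of `K` for an antitone
exponent function `e` (e.g. `Ω•_{𝒳}` modulo the staircase `p^{(r-j)N}`: the reductions
`Ωʲ_{X_{(r-j)N}}`). [folklore] -/
abbrev powQuotient : CochainComplex 𝒜 ℕ :=
  CochainComplex.of (fun j ↦ cokernel (powSMul K q e j)) (powQuotientD K q he) fun j ↦ by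
    rw [← cancel_epi (cokernel.π (powSMul K q e j)), π_powQuotientD_assoc, π_powQuotientD,
      comp_zero, ← Category.assoc, HomologicalComplex.d_comp_d, zero_comp]

/-- The terms of the staircase quotient. [folklore] -/
theorem powQuotient_X (j : ℕ) : (powQuotient K q he).X j = cokernel (powSMul K q e j) := rfl

/-- The differential of the staircase quotient. [folklore] -/
@[simp] theorem powQuotient_d (j : ℕ) :
    (powQuotient K q he).d j (j + 1) = powQuotientD K q he j :=
  CochainComplex.of_d (fun j ↦ cokernel (powSMul K q e j)) (powQuotientD K q he) j

/-- The projection `K ⟶ K / q^{e} K`. [folklore] -/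
def powQuotientπ : K ⟶ powQuotient K q he where
  f j := cokernel.π (powSMul K q e j)
  comm' i j hij := by
    change i + 1 = j at hij
    subst hij
    rw [powQuotient_d, π_powQuotientD]

/-- The components of the projection are the cokernel projections. [folklore] -/
@[simp] theorem powQuotientπ_f (j : ℕ) :
    (powQuotientπ K q he).f j = cokernel.π (powSMul K q e j) := rfl

/-- The projection is degreewise an epimorphism. [folklore] -/
instance epi_powQuotientπ_f (j : ℕ) : Epi ((powQuotientπ K q he).f j) := by
  rw [powQuotientπ_f]; infer_instance

/-- `q^{e j} ≫ π = 0` degreewise. [folklore] -/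
@[reassoc (attr := simp)]
theorem powSMul_comp_powQuotientπ_f (j : ℕ) : powSMul K q e j ≫ (powQuotientπ K q he).f j = 0 :=
  cokernel.condition _

variable {e' : ℕ → ℕ} (he' : Antitone e')

/-- The **reduction map** `K / q^{e'} K ⟶ K / q^{e} K` for `e ≤ e'` (e.g. `Ω_{X_{N'}} → Ω_{X_N}` for
`N' ≥ N`). [folklore] -/
def powQuotientMap (h : e ≤ e') : powQuotient K q he' ⟶ powQuotient K q he where
  f j := cokernel.desc _ (cokernel.π (powSMul K q e j)) (by
    rw [powSMul_eq_smul_powSMul K q h j, Preadditive.zsmul_comp, cokernel.condition, smul_zero])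
  comm' i j hij := by
    change i + 1 = j at hij
    subst hij
    rw [powQuotient_d, powQuotient_d, ← cancel_epi (cokernel.π (powSMul K q e' i)),
      cokernel.π_desc_assoc, π_powQuotientD, π_powQuotientD_assoc, cokernel.π_desc]

/-- `π_{e'} ≫ (reduction) = π_{e}` degreewise (cokernel projections). [folklore] -/
@[reassoc (attr := simp)]
theorem π_comp_powQuotientMap_f (h : e ≤ e') (j : ℕ) :
    cokernel.π (powSMul K q e' j) ≫ (powQuotientMap K q he he' h).f j =
      cokernel.π (powSMul K q e j) :=
  cokernel.π_desc _ _ _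

/-- `π_{e'} ≫ (reduction) = π_{e}` degreewise. [folklore] -/
@[reassoc (attr := simp)]
theorem powQuotientπ_f_comp_powQuotientMap_f (h : e ≤ e') (j : ℕ) :
    (powQuotientπ K q he').f j ≫ (powQuotientMap K q he he' h).f j = (powQuotientπ K q he).f j :=
  cokernel.π_desc _ _ _

/-- `π_{e'} ≫ (reduction) = π_{e}`. [folklore] -/
@[reassoc (attr := simp)]
theorem powQuotientπ_comp_powQuotientMap (h : e ≤ e') :
    powQuotientπ K q he' ≫ powQuotientMap K q he he' h = powQuotientπ K q he := by
  exact HomologicalComplex.hom_ext _ _ fun j ↦ powQuotientπ_f_comp_powQuotientMap_f K q he he' h j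

/-- The reduction map for `e ≤ e` is the identity. [folklore] -/
theorem powQuotientMap_refl : powQuotientMap K q he he le_rfl = 𝟙 _ := by
  refine HomologicalComplex.hom_ext _ _ fun j ↦ coequalizer.hom_ext ?_
  rw [π_comp_powQuotientMap_f, HomologicalComplex.id_f, Category.comp_id]

/-- Reduction maps compose. [folklore] -/
theorem powQuotientMap_comp {e'' : ℕ → ℕ} (he'' : Antitone e'') (h : e ≤ e') (h' : e' ≤ e'') :
    powQuotientMap K q he' he'' h' ≫ powQuotientMap K q he he' h =
      powQuotientMap K q he he'' (h.trans h') := by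
  refine HomologicalComplex.hom_ext _ _ fun j ↦ coequalizer.hom_ext ?_
  rw [HomologicalComplex.comp_f, π_comp_powQuotientMap_f_assoc, π_comp_powQuotientMap_f,
    π_comp_powQuotientMap_f]

end Quotient

/-! ### The staircase image subcomplex `q^{e} Q` -/

section Image

variable (Q : CochainComplex 𝒜 ℕ) (q : ℤ) {e : ℕ → ℕ} (he : Antitone e)

/-- The commutative square from `q ^ e j` (on `Qʲ`) to `q ^ e (j+1)` (on `Qʲ⁺¹`) with horizontal maps
`q^{e j - e (j+1)} • d` and `d`, as a morphism of arrows. [folklore] -/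
def powArrowHom (j : ℕ) : Arrow.mk (powSMul Q q e j) ⟶ Arrow.mk (powSMul Q q e (j + 1)) :=
  Arrow.homMk' (((q ^ (e j - e (j + 1))) : ℤ) • Q.d j (j + 1)) (Q.d j (j + 1))
    (powSMul_comp_d Q q he j).symm

/-- The differential of the staircase image subcomplex `q^{e j} Qʲ → q^{e (j+1)} Qʲ⁺¹` (the map on
images induced by `powArrowHom`, Mathlib's `image.map`). [folklore] -/
def powImageD (j : ℕ) : image (powSMul Q q e j) ⟶ image (powSMul Q q e (j + 1)) :=
  image.map (powArrowHom Q q he j)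

/-- `d̃ ≫ ι = ι ≫ d` for the staircase image differential. [folklore] -/
@[reassoc (attr := simp)]
theorem powImageD_ι (j : ℕ) :
    powImageD Q q he j ≫ image.ι _ = image.ι _ ≫ Q.d j (j + 1) :=
  image.map_homMk'_ι _

/-- The **staircase image subcomplex** `q^{e} Q = (q^{e j} Qʲ)ⱼ` of a complex `Q` for an antitone
exponent function `e` (e.g. X. Hu's `[p^{rM}𝒪_{X_{rN}} → p^{(r-1)M}Ω¹ → ⋯]` inside the reductions of
`Ω•`). [folklore] -/
abbrev powImage : CochainComplex 𝒜 ℕ :=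
  CochainComplex.of (fun j ↦ image (powSMul Q q e j)) (powImageD Q q he) fun j ↦ by
    rw [← cancel_mono (image.ι (powSMul Q q e (j + 1 + 1))), Category.assoc, powImageD_ι,
      powImageD_ι_assoc, HomologicalComplex.d_comp_d, comp_zero, zero_comp]

/-- The terms of the staircase image subcomplex. [folklore] -/
theorem powImage_X (j : ℕ) : (powImage Q q he).X j = image (powSMul Q q e j) := rfl

/-- The differential of the staircase image subcomplex. [folklore] -/
@[simp] theorem powImage_d (j : ℕ) : (powImage Q q he).d j (j + 1) = powImageD Q q he j :=
  CochainComplex.of_d (fun j ↦ image (powSMul Q q e j)) (powImageD Q q he) j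

/-- The inclusion `q^{e} Q ⟶ Q`. [folklore] -/
def powImageι : powImage Q q he ⟶ Q where
  f j := image.ι (powSMul Q q e j)
  comm' i j hij := by
    change i + 1 = j at hij
    subst hij
    rw [powImage_d, powImageD_ι]

/-- The components of the inclusion are the image inclusions. [folklore] -/
@[simp] theorem powImageι_f (j : ℕ) : (powImageι Q q he).f j = image.ι (powSMul Q q e j) := rfl

/-- The inclusion is degreewise a monomorphism. [folklore] -/
instance mono_powImageι_f (j : ℕ) : Mono ((powImageι Q q he).f j) := by
  rw [powImageι_f]; infer_instance

variable {e' : ℕ → ℕ} (he' : Antitone e')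

/-- The components of the inclusion `q^{e'} Q ⊆ q^{e} Q` for `e ≤ e'` (map on images induced by the
square `q^{e' j} = (q^{e' j - e j}) ≫ q^{e j}`). [folklore] -/
def powImageLEf (h : e ≤ e') (j : ℕ) : image (powSMul Q q e' j) ⟶ image (powSMul Q q e j) :=
  image.map (Arrow.homMk' (((q ^ (e' j - e j)) : ℤ) • 𝟙 (Q.X j)) (𝟙 (Q.X j)) (by
    rw [Category.comp_id, Preadditive.zsmul_comp, Category.id_comp, ← powSMul_eq_smul_powSMul Q q h j]))

/-- `(q^{e'} Q ⊆ q^{e} Q) ≫ ι = ι` degreewise. [folklore] -/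
@[reassoc (attr := simp)]
theorem powImageLEf_ι (h : e ≤ e') (j : ℕ) :
    powImageLEf Q q h j ≫ image.ι (powSMul Q q e j) = image.ι (powSMul Q q e' j) :=
  (image.map_homMk'_ι _).trans (Category.comp_id _)

/-- **`q^{e'} Q ⊆ q^{e} Q` for `e ≤ e'`**: the inclusion of staircase image subcomplexes (e.g.
`p^{(r-j)M}Ω ⊆ p^{(r-j)M'}Ω` for `M' ≤ M`, the first map of Hu's three-term sequence). [folklore] -/
def powImageLE (h : e ≤ e') : powImage Q q he' ⟶ powImage Q q he where
  f j := powImageLEf Q q h j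
  comm' i j hij := by
    change i + 1 = j at hij
    subst hij
    rw [powImage_d, powImage_d, ← cancel_mono (image.ι (powSMul Q q e (i + 1))), Category.assoc,
      Category.assoc, powImageD_ι, powImageLEf_ι, powImageD_ι, powImageLEf_ι_assoc]

/-- The components of `powImageLE`. [folklore] -/
@[simp] theorem powImageLE_f (h : e ≤ e') (j : ℕ) :
    (powImageLE Q q he he' h).f j = powImageLEf Q q h j := rfl

/-- `(q^{e'} Q ⊆ q^{e} Q) ≫ ι = ι`. [folklore] -/
@[reassoc (attr := simp)]
theorem powImageLE_comp_powImageι (h : e ≤ e') :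
    powImageLE Q q he he' h ≫ powImageι Q q he = powImageι Q q he' :=
  HomologicalComplex.hom_ext _ _ fun j ↦ powImageLEf_ι Q q h j

/-- The components of the push-forward of staircase images along a chain map `φ : Q ⟶ Q'` (map on
images induced by the square `q^{e j} ≫ φʲ = φʲ ≫ q^{e j}`). [folklore] -/
def powImageMapf {Q' : CochainComplex 𝒜 ℕ} (φ : Q ⟶ Q') (j : ℕ) :
    image (powSMul Q q e j) ⟶ image (powSMul Q' q e j) :=
  image.map (Arrow.homMk' (φ.f j) (φ.f j) (powSMul_comp q e φ j).symm)

/-- `(push-forward) ≫ ι = ι ≫ φʲ` degreewise. [folklore] -/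
@[reassoc (attr := simp)]
theorem powImageMapf_ι {Q' : CochainComplex 𝒜 ℕ} (φ : Q ⟶ Q') (j : ℕ) :
    powImageMapf Q q φ j ≫ image.ι (powSMul Q' q e j) = image.ι (powSMul Q q e j) ≫ φ.f j :=
  image.map_homMk'_ι _

/-- The **push-forward of staircase images along a chain map** `φ : Q ⟶ Q'`:
`q^{e} Q ⟶ q^{e} Q'` (e.g. along the reduction `Ω_{X_N} → Ω_{X_M}`, the second map of Hu's
three-term sequence). [folklore] -/
def powImageMap {Q' : CochainComplex 𝒜 ℕ} (φ : Q ⟶ Q') : powImage Q q he ⟶ powImage Q' q he where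
  f j := powImageMapf Q q φ j
  comm' i j hij := by
    change i + 1 = j at hij
    subst hij
    rw [powImage_d, powImage_d, ← cancel_mono (image.ι (powSMul Q' q e (i + 1))), Category.assoc,
      Category.assoc, powImageD_ι, powImageMapf_ι, powImageD_ι_assoc, powImageMapf_ι_assoc,
      φ.comm]

/-- The components of `powImageMap`. [folklore] -/
@[simp] theorem powImageMap_f {Q' : CochainComplex 𝒜 ℕ} (φ : Q ⟶ Q') (j : ℕ) :
    (powImageMap Q q he φ).f j = powImageMapf Q q φ j := rfl

/-- `(push-forward) ≫ ι = ι ≫ φ`. [folklore] -/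
@[reassoc (attr := simp)]
theorem powImageMap_comp_powImageι {Q' : CochainComplex 𝒜 ℕ} (φ : Q ⟶ Q') :
    powImageMap Q q he φ ≫ powImageι Q' q he = powImageι Q q he ≫ φ :=
  HomologicalComplex.hom_ext _ _ fun j ↦ powImageMapf_ι Q q φ j

end Image

end Literature.Algebra.Homology

end
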